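import Mathlib.Data.ZMod.Basic
import Mathlib.Data.Nat.ChineseRemainder
import Mathlib.Data.Nat.Factorization.Basic
import Mathlib.LinearAlgebra.Matrix.Block
import Mathlib.LinearAlgebra.Matrix.NonsingularInverse
import Mathlib.RingTheory.Ideal.Operations
import HarnessLib

/-!
# Unimodular vectors over `ℤ/qℤ` extend to invertible matrices

Topic `Algebra/Module`. A vector `v ∈ Rⁿ` over a commutative ring is *unimodular* if its coordinates
generate the unit ideal (`IsUnimodularVector v`: `∑ cᵢ vᵢ = 1` for some `c`). Over `R = ℤ/qℤ` (`q ≥ 1`)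
every unimodular vector of length `n + 1` is the leftmost column of a matrix invertible over `R`
(`exists_matrix_isUnit_det_col_eq`). This is the algebraic step of the reduction of
Brakerski–Langlois–Peikert–Regev–Stehlé, *Classical hardness of learning with errors* (STOC 2013),
Lemma 4.3: *"we proceed by finding a matrix `U ∈ ℤ^{n×n}` that is invertible modulo `q` and whose
leftmost column is `a'`. Such a matrix exists, and can be found efficiently. For instance, using the
extended GCD algorithm, we find an `n × n` unimodular matrix `R` such that `R a' = (r, 0, …, 0)ᵀ`.
Then `R⁻¹ · diag(r, 1, …, 1)` is the desired matrix"* (there `r = gcd(a')` is coprime to `q`, which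
modulo `q` is exactly unimodularity: `isUnimodularVector_iff_forall_prime` below).

The proof given here is the semilocal one (equivalent data, no integer lifting of the whole vector):
`ℤ/qℤ` has finitely many maximal ideals `(p)`, `p | q` prime, so by the Chinese remainder theorem
there are `t₁, …, tₙ` with `u = v₀ + ∑ tᵢ vᵢ` a unit (`exists_isUnit_add_sum_mul`: modulo each `p`,
take all `tᵢ = 0` if `p ∤ v₀`, else `t_j = 1` at one coordinate `v_j` not divisible by `p`, which
exists by unimodularity); then `U = E · G` with `E = 1 - ∑ tᵢ E_{0,i}` (upper unitriangular) and `G`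
the lower triangular matrix with leftmost column `(u, v₁, …, vₙ)` and unit diagonal elsewhere has
`det U = u` and leftmost column `v` (`completionMatrix`).

* `IsUnimodularVector`, its decidability over a finite ring, `IsUnimodularVector.map` (ring homomorphisms)
  (the tree's `LinearMap.BilinForm.IsUnimodular` of `Topology/FourManifolds` is the unrelated notion for forms);
* `not_forall_dvd_val_of_isUnimodularVector` — a unimodular vector over `ℤ/qℤ` is not divisible by any prime
  `p | q` coordinatewise; `isUnimodularVector_of_forall_prime`, `isUnimodularVector_iff_forall_prime` — conversely
  (CRT), so unimodularity is the printed "gcd of the coordinates coprime to `q`";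
* `exists_isUnit_add_sum_mul`, `completionMatrix`, `det_completionMatrix`, `completionMatrix_col_zero`,
  **`exists_matrix_isUnit_det_col_eq`**.
* `isUnimodularVector_iff_span_eq_top` — bridge to Mathlib: unimodular iff `Ideal.span (Set.range v) = ⊤`.

## References

* Z. Brakerski, A. Langlois, C. Peikert, O. Regev, D. Stehlé, *Classical hardness of learning with
  errors*, STOC 2013; arXiv:1306.0281, proof of Lemma 4.3.
* T. Y. Lam, *Serre's problem on projective modules*, Springer 2006, Ch. I §4 (unimodular rows;
  completion over semilocal rings) — background only, not followed.
-/

namespace Literature.Algebra.Module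

open Matrix Finset
open scoped Function

/-! ### Unimodular vectors -/

section General

variable {R S : Type*} [CommRing R] [CommRing S] {n : ℕ}

/-- A vector `v ∈ Rⁿ` is *unimodular* if its coordinates generate the unit ideal, i.e.
`∑ᵢ cᵢ vᵢ = 1` for some coefficient vector `c`. [folklore] -/
def IsUnimodularVector (v : Fin n → R) : Prop :=
  ∃ c : Fin n → R, c ⬝ᵥ v = 1

/-- Over a finite ring with decidable equality, unimodularity is decidable (finitely many `c`).
[folklore] -/
instance IsUnimodularVector.decidable [Fintype R] [DecidableEq R] (v : Fin n → R) :
    Decidable (IsUnimodularVector v) :=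
  Fintype.decidableExistsFintype

/-- Unimodularity is preserved by ring homomorphisms. [folklore] -/
theorem IsUnimodularVector.map {v : Fin n → R} (hv : IsUnimodularVector v) (f : R →+* S) :
    IsUnimodularVector (f ∘ v) := by
  obtain ⟨c, hc⟩ := hv
  refine ⟨f ∘ c, ?_⟩
  rw [← RingHom.map_dotProduct, hc, map_one]

/-- Over a nontrivial ring a unimodular vector has a nonzero coordinate. [folklore] -/
theorem IsUnimodularVector.exists_ne_zero [Nontrivial R] {v : Fin n → R} (hv : IsUnimodularVector v) :
    ∃ i, v i ≠ 0 := by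
  by_contra h
  push Not at h
  obtain ⟨c, hc⟩ := hv
  rw [show v = 0 from funext h, dotProduct_zero] at hc
  exact zero_ne_one hc

end General

/-! ### Over `ℤ/qℤ`: unimodular = not divisible by any prime factor of `q` -/

section ZMod

variable {q : ℕ} [NeZero q] {n : ℕ}

/-- The reduction map `ℤ/qℤ → ℤ/pℤ` for `p | q` sends `x` to the class of its representative
`x.val`. [folklore] -/
theorem castHom_apply_eq_natCast_val {p : ℕ} (hp : p ∣ q) (x : ZMod q) :
    ZMod.castHom hp (ZMod p) x = ((x.val : ℕ) : ZMod p) := by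
  rw [ZMod.castHom_apply, ZMod.cast_eq_val]

/-- **A unimodular vector over `ℤ/qℤ` is not coordinatewise divisible by a prime `p | q`** (reduce a
relation `∑ cᵢ vᵢ = 1` modulo `p`: `0 = 1` in `ℤ/pℤ`). [folklore] -/
theorem not_forall_dvd_val_of_isUnimodularVector {v : Fin n → ZMod q} (hv : IsUnimodularVector v) {p : ℕ}
    (hp : p.Prime) (hpq : p ∣ q) : ¬ ∀ i, p ∣ (v i).val := by
  intro hall
  haveI : Fact (1 < p) := ⟨hp.one_lt⟩
  obtain ⟨i, hi⟩ := (hv.map (ZMod.castHom hpq (ZMod p))).exists_ne_zero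
  exact hi (by rw [Function.comp_apply, castHom_apply_eq_natCast_val,
    (ZMod.natCast_eq_zero_iff _ _).2 (hall i)])

/-- **Local-to-global for units of `ℤ/qℤ`**: a natural number not divisible by any prime factor of
`q` is a unit modulo `q`. [folklore] -/
theorem isUnit_natCast_of_forall_prime {C : ℕ} (hC : ∀ p ∈ q.primeFactors, ¬ p ∣ C) :
    IsUnit (C : ZMod q) := by
  rw [ZMod.isUnit_iff_coprime]
  refine Nat.Coprime.symm (Nat.coprime_of_dvd fun p hp hpq hpC => hC p ?_ hpC)
  exact Nat.mem_primeFactors.2 ⟨hp, hpq, NeZero.ne q⟩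

/-- **Unit combination (stable-range step).** If `v ∈ (ℤ/qℤ)^{n+1}` is unimodular then
`v₀ + ∑ᵢ tᵢ v_{i+1}` is a unit for suitable `t`: by the Chinese remainder theorem choose `tᵢ ≡ 0`
modulo the primes `p | q` not dividing `v₀`, and modulo the other primes `p | q` choose `t ≡ e_j` for
a coordinate `v_{j+1}` not divisible by `p` (which exists by unimodularity). [folklore] -/
theorem exists_isUnit_add_sum_mul {v : Fin (n + 1) → ZMod q} (hv : IsUnimodularVector v) :
    ∃ t : Fin n → ZMod q, IsUnit (v 0 + ∑ i, t i * v i.succ) := by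
  classical
  -- for a prime factor dividing `v₀`, a later coordinate it does not divide
  have hex : ∀ p ∈ q.primeFactors, p ∣ (v 0).val → ∃ j : Fin n, ¬ p ∣ (v j.succ).val := by
    intro p hp h0
    by_contra hall
    push Not at hall
    refine not_forall_dvd_val_of_isUnimodularVector hv (Nat.prime_of_mem_primeFactors hp)
      (Nat.dvd_of_mem_primeFactors hp) fun i => ?_
    exact Fin.cases h0 hall i
  -- the prescribed residues `τ p i ∈ {0, 1}`
  let τ : ℕ → Fin n → ℕ := fun p i =>
    if h : p ∈ q.primeFactors ∧ p ∣ (v 0).val then (if i = (hex p h.1 h.2).choose then 1 else 0) else 0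
  have hcop : Set.Pairwise (↑q.primeFactors : Set ℕ) (Nat.Coprime on id) := by
    intro p hp p' hp' hne
    exact (Nat.coprime_primes (Nat.prime_of_mem_primeFactors hp)
      (Nat.prime_of_mem_primeFactors hp')).2 hne
  have hne0 : ∀ p ∈ q.primeFactors, (id p : ℕ) ≠ 0 := fun p hp =>
    (Nat.prime_of_mem_primeFactors hp).ne_zero
  -- CRT, coordinate by coordinate
  let T : Fin n → ℕ := fun i => (Nat.chineseRemainderOfFinset (fun p => τ p i) id q.primeFactors hne0 hcop : ℕ)
  have hT : ∀ i, ∀ p ∈ q.primeFactors, T i ≡ τ p i [MOD p] := fun i p hp =>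
    (Nat.chineseRemainderOfFinset (fun p => τ p i) id q.primeFactors hne0 hcop).2 p hp
  refine ⟨fun i => (T i : ZMod q), ?_⟩
  -- the combination is the class of a natural number `C`
  set C : ℕ := (v 0).val + ∑ i, T i * (v i.succ).val with hCdef
  have hC : (v 0 + ∑ i, (T i : ZMod q) * v i.succ) = (C : ZMod q) := by
    rw [hCdef]
    push_cast
    simp only [ZMod.natCast_zmod_val]
  rw [hC]
  refine isUnit_natCast_of_forall_prime fun p hp hpC => ?_
  have hpp : p.Prime := Nat.prime_of_mem_primeFactors hp
  haveI : Fact (1 < p) := ⟨hpp.one_lt⟩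
  -- reduce `C` modulo `p`
  have hCp : (C : ZMod p) = ((v 0).val : ZMod p) + ∑ i, (τ p i : ZMod p) * ((v i.succ).val : ZMod p) := by
    rw [hCdef]
    push_cast
    congr 1
    refine Finset.sum_congr rfl fun i _ => ?_
    rw [(ZMod.natCast_eq_natCast_iff _ _ _).2 (hT i p hp)]
  have hC0 : (C : ZMod p) = 0 := (ZMod.natCast_eq_zero_iff _ _).2 hpC
  by_cases h0 : p ∣ (v 0).val
  · -- `τ p = e_j`: `C ≡ v_{j+1} ≢ 0 (mod p)`
    have hτ : ∀ i, τ p i = if i = (hex p hp h0).choose then 1 else 0 := fun i => by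
      simp only [τ, dif_pos (And.intro hp h0)]
    have hj := (hex p hp h0).choose_spec
    rw [hCp, (ZMod.natCast_eq_zero_iff _ _).2 h0, zero_add] at hC0
    simp_rw [hτ] at hC0
    simp only [Nat.cast_ite, Nat.cast_one, Nat.cast_zero, ite_mul, one_mul, zero_mul,
      Finset.sum_ite_eq', Finset.mem_univ, if_true] at hC0
    exact hj ((ZMod.natCast_eq_zero_iff _ _).1 hC0)
  · -- `τ p = 0`: `C ≡ v₀ ≢ 0 (mod p)`
    have hτ : ∀ i, τ p i = 0 := fun i => by
      simp only [τ, dif_neg (not_and.2 fun _ => h0)]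
    simp_rw [hCp, hτ, Nat.cast_zero, zero_mul, Finset.sum_const_zero, add_zero] at hC0
    exact h0 ((ZMod.natCast_eq_zero_iff _ _).1 hC0)

/-- Conversely to `not_forall_dvd_val_of_isUnimodularVector`: a vector over `ℤ/qℤ` having, for every
prime `p | q`, some coordinate not divisible by `p` is unimodular. By the Chinese remainder theorem
choose natural numbers `Tᵢ` with `T ≡ e_{j(p)} (mod p)` for a coordinate `v_{j(p)}` not divisible by
`p`; then `∑ Tᵢ vᵢ` is a unit `u` modulo `q` (it is `≢ 0` modulo every `p | q`), and `c = u⁻¹ T`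
works. [folklore] -/
theorem isUnimodularVector_of_forall_prime {v : Fin n → ZMod q}
    (h : ∀ p ∈ q.primeFactors, ∃ i, ¬ p ∣ (v i).val) : IsUnimodularVector v := by
  classical
  -- choose, modulo each prime factor `p`, the indicator of a coordinate not divisible by `p`
  let τ : ℕ → Fin n → ℕ := fun p i =>
    if hp : p ∈ q.primeFactors then (if i = (h p hp).choose then 1 else 0) else 0
  have hcop : Set.Pairwise (↑q.primeFactors : Set ℕ) (Nat.Coprime on id) := by
    intro p hp p' hp' hne
    exact (Nat.coprime_primes (Nat.prime_of_mem_primeFactors hp)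
      (Nat.prime_of_mem_primeFactors hp')).2 hne
  have hne0 : ∀ p ∈ q.primeFactors, (id p : ℕ) ≠ 0 := fun p hp =>
    (Nat.prime_of_mem_primeFactors hp).ne_zero
  let T : Fin n → ℕ := fun i => (Nat.chineseRemainderOfFinset (fun p => τ p i) id q.primeFactors hne0 hcop : ℕ)
  have hT : ∀ i, ∀ p ∈ q.primeFactors, T i ≡ τ p i [MOD p] := fun i p hp =>
    (Nat.chineseRemainderOfFinset (fun p => τ p i) id q.primeFactors hne0 hcop).2 p hp
  -- `C = ∑ Tᵢ vᵢ` is a unit; then `c = u⁻¹ T` works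
  set C : ℕ := ∑ i, T i * (v i).val with hCdef
  have hC : (∑ i, (T i : ZMod q) * v i) = (C : ZMod q) := by
    rw [hCdef]
    push_cast
    simp only [ZMod.natCast_zmod_val]
  have hunit : IsUnit (C : ZMod q) := by
    refine isUnit_natCast_of_forall_prime fun p hp hpC => ?_
    have hpp : p.Prime := Nat.prime_of_mem_primeFactors hp
    haveI : Fact (1 < p) := ⟨hpp.one_lt⟩
    have hτ : ∀ i, τ p i = if i = (h p hp).choose then 1 else 0 := fun i => by
      simp only [τ, dif_pos hp]
    have hj := (h p hp).choose_spec
    have hC0 : (C : ZMod p) = 0 := (ZMod.natCast_eq_zero_iff _ _).2 hpC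
    rw [hCdef] at hC0
    push_cast at hC0
    rw [Finset.sum_congr rfl fun i _ => by rw [(ZMod.natCast_eq_natCast_iff _ _ _).2 (hT i p hp)]] at hC0
    simp_rw [hτ] at hC0
    simp only [Nat.cast_ite, Nat.cast_one, Nat.cast_zero, ite_mul, one_mul, zero_mul,
      Finset.sum_ite_eq', Finset.mem_univ, if_true] at hC0
    exact hj ((ZMod.natCast_eq_zero_iff _ _).1 hC0)
  obtain ⟨u, hu⟩ := hunit
  refine ⟨fun i => (↑u⁻¹ : ZMod q) * (T i : ZMod q), ?_⟩
  rw [dotProduct, Finset.sum_congr rfl fun i _ => mul_assoc _ _ _, ← Finset.mul_sum, hC, ← hu,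
    Units.inv_mul]

/-- **Unimodularity over `ℤ/qℤ` is the printed condition** "the gcd of the coordinates is coprime to
`q`": `v` is unimodular iff no prime factor of `q` divides all the representatives `(vᵢ).val`.
[cite: BrakerskiEtAl2013, Lemma 4.3 (proof)] -/
theorem isUnimodularVector_iff_forall_prime {v : Fin n → ZMod q} :
    IsUnimodularVector v ↔ ∀ p ∈ q.primeFactors, ∃ i, ¬ p ∣ (v i).val :=
  ⟨fun hv _ hp => not_forall.1 (not_forall_dvd_val_of_isUnimodularVector hv
    (Nat.prime_of_mem_primeFactors hp) (Nat.dvd_of_mem_primeFactors hp)),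
    isUnimodularVector_of_forall_prime⟩

/-! ### The completion matrix -/

/-- The completion matrix `U = E · G` for `v ∈ R^{n+1}` and coefficients `t`, with
`u = v₀ + ∑ tᵢ v_{i+1}`: `E = 1 - ∑ᵢ tᵢ E_{0,i+1}` (upper unitriangular: it subtracts `∑ tᵢ x_{i+1}` from
the first coordinate) and `G` lower triangular with leftmost column `(u, v₁, …, vₙ)` and diagonal
`(u, 1, …, 1)`. Kept in product form; `det U = u` (`det_completionMatrix`) and the leftmost column of
`U` is `v` (`completionMatrix_col_zero`). This plays the role of the printed `R⁻¹ · diag(r, 1, …, 1)`.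
[cite: BrakerskiEtAl2013, Lemma 4.3 (proof: "R⁻¹ · diag(r, 1, …, 1) is the desired matrix")] -/
def completionMatrix {R : Type*} [CommRing R] (v : Fin (n + 1) → R) (t : Fin n → R) :
    Matrix (Fin (n + 1)) (Fin (n + 1)) R :=
  Matrix.of (fun i j : Fin (n + 1) => if i = j then (1 : R) else if i = 0 then -(vecCons 0 t j) else 0) *
    Matrix.of fun i j : Fin (n + 1) =>
      if j = 0 then vecCons (v 0 + ∑ l, t l * v l.succ) (vecTail v) i else if i = j then 1 else 0

/-- The left factor `E = 1 - ∑ᵢ tᵢ E_{0,i+1}` is upper unitriangular, `det E = 1`. [folklore] -/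
theorem det_completionMatrix_left {R : Type*} [CommRing R] (t : Fin n → R) :
    (Matrix.of fun i j : Fin (n + 1) =>
      if i = j then (1 : R) else if i = 0 then -(vecCons 0 t j) else 0).det = 1 := by
  rw [det_of_upperTriangular]
  · exact Finset.prod_eq_one fun i _ => by simp
  · intro i j hij
    have hij' : j < i := hij
    have hi0 : i ≠ 0 := fun h => (Fin.not_lt.2 (Fin.zero_le j)) (h ▸ hij')
    simp [ne_of_gt hij', hi0]

/-- The right factor `G` (leftmost column `(u, v₁, …, vₙ)`, unit diagonal elsewhere) is lower
triangular, `det G = u`. [folklore] -/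
theorem det_completionMatrix_right {R : Type*} [CommRing R] (v : Fin (n + 1) → R) (u : R) :
    (Matrix.of fun i j : Fin (n + 1) =>
      if j = 0 then vecCons u (vecTail v) i else if i = j then 1 else 0).det = u := by
  rw [det_of_lowerTriangular]
  · rw [Fin.prod_univ_succ]
    simp [Fin.succ_ne_zero]
  · intro i j hij
    have hij' : i < j := hij
    have hj0 : j ≠ 0 := ne_of_gt (lt_of_le_of_lt (Fin.zero_le i) hij')
    simp [hj0, ne_of_lt hij']

/-- `det U = v₀ + ∑ tᵢ v_{i+1}`. [folklore] -/
theorem det_completionMatrix {R : Type*} [CommRing R] (v : Fin (n + 1) → R) (t : Fin n → R) :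
    (completionMatrix v t).det = v 0 + ∑ l, t l * v l.succ := by
  rw [completionMatrix, det_mul, det_completionMatrix_left, det_completionMatrix_right, one_mul]

/-- The leftmost column of `U` is `v`: `G e₀ = (u, v₁, …, vₙ)` and `E` subtracts `∑ tᵢ v_{i+1}` from the
first coordinate, giving back `v₀`. [cite: BrakerskiEtAl2013, Lemma 4.3 (proof: "whose leftmost column is a'")] -/
theorem completionMatrix_col_zero {R : Type*} [CommRing R] (v : Fin (n + 1) → R) (t : Fin n → R) :
    (fun i => completionMatrix v t i 0) = v := by
  funext i
  rw [completionMatrix, Matrix.mul_apply]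
  simp only [of_apply, if_true]
  refine Fin.cases ?_ (fun j => ?_) i
  · rw [Fin.sum_univ_succ]
    simp only [if_true, cons_val_zero, one_mul, cons_val_succ, vecTail, Function.comp_apply]
    simp only [(Fin.succ_ne_zero _).symm, if_false, neg_mul, Finset.sum_neg_distrib]
    abel
  · simp only [Fin.succ_ne_zero, if_false, vecTail]
    rw [Finset.sum_eq_single j.succ]
    · simp
    · intro l _ hl
      rw [if_neg (Ne.symm hl), zero_mul]
    · exact fun h => absurd (Finset.mem_univ _) h

/-- **Every unimodular vector over `ℤ/qℤ` is the leftmost column of an invertible matrix** (the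
algebraic step of BLPRS 2013, proof of Lemma 4.3: "a matrix `U` that is invertible modulo `q` and
whose leftmost column is `a'` … exists, and can be found efficiently"). [cite: BrakerskiEtAl2013, Lemma 4.3 (proof)] -/
theorem exists_matrix_isUnit_det_col_eq {v : Fin (n + 1) → ZMod q} (hv : IsUnimodularVector v) :
    ∃ U : Matrix (Fin (n + 1)) (Fin (n + 1)) (ZMod q), IsUnit U.det ∧ (fun i => U i 0) = v := by
  obtain ⟨t, ht⟩ := exists_isUnit_add_sum_mul hv
  exact ⟨completionMatrix v t, by rwa [det_completionMatrix], completionMatrix_col_zero v t⟩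

/-- A completion PROCEDURE: on unimodular `v` some invertible matrix with leftmost column `v` (by
choice from `exists_matrix_isUnit_det_col_eq`), the identity matrix otherwise. (The printed procedure
is the extended GCD algorithm; any procedure with this specification serves the reduction.)
[cite: BrakerskiEtAl2013, Lemma 4.3 (proof)] -/
noncomputable def unimodularCompletion (v : Fin (n + 1) → ZMod q) :
    Matrix (Fin (n + 1)) (Fin (n + 1)) (ZMod q) :=
  by classical exact if h : IsUnimodularVector v then (exists_matrix_isUnit_det_col_eq h).choose else 1

/-- Specification of `unimodularCompletion` on unimodular vectors: invertible, leftmost column `v`.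
[cite: BrakerskiEtAl2013, Lemma 4.3 (proof)] -/
theorem unimodularCompletion_spec {v : Fin (n + 1) → ZMod q} (hv : IsUnimodularVector v) :
    IsUnit (unimodularCompletion v).det ∧ (fun i => unimodularCompletion v i 0) = v := by
  classical
  rw [unimodularCompletion, dif_pos hv]
  exact (exists_matrix_isUnit_det_col_eq hv).choose_spec

end ZMod

/-! ### Bridge to ideals -/

section IdealBridge

variable {R : Type*} [CommRing R] {n : ℕ}

/-- **Bridge to Mathlib's ideals**: `v` is unimodular iff its coordinates generate the unit ideal,
`Ideal.span (Set.range v) = ⊤` (both say `∑ cᵢ vᵢ = 1` for some `c`; `Ideal.mem_span_range_iff_exists_fun`).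
[folklore] -/
theorem isUnimodularVector_iff_span_eq_top (v : Fin n → R) :
    IsUnimodularVector v ↔ Ideal.span (Set.range v) = ⊤ := by
  rw [Ideal.eq_top_iff_one, Ideal.mem_span_range_iff_exists_fun]
  rfl

end IdealBridge


end Literature.Algebra.Module
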